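import Mathlib
import HarnessLib
import Summits.ValiantsHypothesis.ValiantsHypothesis.Theorems.MonotoneRestorationOrbitRestorationQPSmlRestoration
import Summits.ValiantsHypothesis.ValiantsHypothesis.Theorems.MonotoneRestorationOrbitRestorationQPSmlAffineSpan
import Summits.ValiantsHypothesis.ValiantsHypothesis.Theorems.MonotoneRestorationOrbitRestorationQPSmlAffineInjective

/-!
# THE AFFINE SET-MULTILINEAR STRATUM OF A_∞: column-set-multilinear `ΣΠΣ` circuits WITH CONSTANTS are orbit-restorable
(crux `OrbitRestorationQP`, stmt-ValiantsHypothesis-18293 — lane SML of stub A_∞ `stub_sigmaPiSigmaValue`)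

`SmlRestoration.colSml_restoration` restores matrix-symmetric families given by column-set-multilinear `ΣΠΣ` circuits whose
gates are column-LINEAR forms.  A genuine depth-three circuit has AFFINE gates; this file removes the homogeneity restriction:

**THEOREM `affineColSml_restoration`.**  Let `f` be a MATRIX-SYMMETRIC family such that every `f n` is computed by a
column-set-multilinear `ΣΠΣ` circuit with constants and at most `n^c + c` product gates,
`f n = Σ_{t<s} Π_{b<n} (β_{t,b} + Σ_a α_{t,b,a} x_{(a,b)})`, `s ≤ n^c + c`.  Then `∃ c', ∀ n, QPOrbitRestorable c' n (f n)`
(indeed with polynomial orbits).  Cancellations between the product gates are allowed; the given circuit need not be symmetric.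

Chain (all landed in this lane): affine flattening bound (`…SmlAffineFlattening`) ⇒ narrowness of every homogeneous component
of the symmetric shadow (`…SmlAffineNarrow`) ⇒ the shadow lies in the span of the affine generators
`R β τ = Σ_g (β + p_1 + Σ_i τ_i y_{g i})^n` (`…SmlAffineSpan`) ⇒ by injectivity of `x_{ab} ↦ y_a` on column-symmetric affine
column-sml expressions (`…SmlAffineInjective`) the **AFFINE EQUIVARIANT NORMAL FORM**
`f n = Σ_{β,τ,g} d_{β,τ} · Π_b (β + C_b + Σ_i τ_i x_{(g i,b)})` (`exists_equivariant_form_affine`, `β ∈ {0..n}`,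
`τ ∈ {0..n}^{c+1}`, `g ∈ [n]^{c+1}`) — an `S_n`-stable multiset of `(n+1)^{c+2} n^{c+1}` products of affine forms — ⇒ the
landed stub B `stub_circuitOfEquivariantTerms`; small `n` by brute force.

Honest label: an unconditional stratum of the off-path sub-rung A_∞ (strictly containing the landed column-linear stratum); the
stub itself (all of `PDClass 1`), the crux and VP ≠ VNP are not touched. [folklore]
-/

set_option linter.dupNamespace false

namespace Summit.ValiantsHypothesis.ValiantsHypothesis.Theorems.SmlAffineRestoration

open MvPolynomial Finset OrbitRestorationQPDepthThreeRung SmlNumeric SmlEquivariantForm SmlRestoration SmlAffineSpan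
  SmlAffineInjective SmlAffineNarrow

/-! ### The affine equivariant normal form -/

/-- **Affine equivariant normal form.**  A row- and column-symmetric affine column-sml expression with `s < C(n-(w+1), w+1)`
product gates (`2(w+1) ≤ n`) equals `Σ_{(β,τ)} Σ_g C (d (β,τ)) · Π_b (β + C_b + Σ_i τ_i x_{(g i,b)})` for some grid
coefficients `d`. [folklore] -/
theorem exists_equivariant_form_affine {n s w : ℕ} (h2w : 2 * (w + 1) ≤ n) (β : Fin s → Fin n → ℂ)
    (α : Fin s → Fin n → Fin n → ℂ)
    (hrow : ∀ σ : Equiv.Perm (Fin n), rename (fun v : Fin n × Fin n => (σ v.1, v.2))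
      (∑ t : Fin s, ∏ b : Fin n, (C (β t b) + ∑ a : Fin n, C (α t b a) * X (a, b)) : MvPolynomial (Fin n × Fin n) ℂ) =
      ∑ t : Fin s, ∏ b : Fin n, (C (β t b) + ∑ a : Fin n, C (α t b a) * X (a, b)))
    (hcol : ∀ τ : Equiv.Perm (Fin n), rename (fun v : Fin n × Fin n => (v.1, τ v.2))
      (∑ t : Fin s, ∏ b : Fin n, (C (β t b) + ∑ a : Fin n, C (α t b a) * X (a, b)) : MvPolynomial (Fin n × Fin n) ℂ) =
      ∑ t : Fin s, ∏ b : Fin n, (C (β t b) + ∑ a : Fin n, C (α t b a) * X (a, b)))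
    (hs : s < Nat.choose (n - (w + 1)) (w + 1)) :
    ∃ d : Fin (n + 1) × (Fin w → Fin (n + 1)) → ℂ,
      (∑ t : Fin s, ∏ b : Fin n, (C (β t b) + ∑ a : Fin n, C (α t b a) * X (a, b)) : MvPolynomial (Fin n × Fin n) ℂ) =
        ∑ βτg : (Fin (n + 1) × (Fin w → Fin (n + 1))) × (Fin w → Fin n), C (d βτg.1) *
          ∏ b : Fin n, (C ((βτg.1.1 : ℕ) : ℂ) +
            ∑ a : Fin n, C (1 + ∑ i : Fin w, if βτg.2 i = a then ((βτg.1.2 i : ℕ) : ℂ) else 0) * X (a, b)) := by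
  classical
  have hn : 1 ≤ n := by omega
  obtain ⟨b₀⟩ : Nonempty (Fin n) := ⟨⟨0, by omega⟩⟩
  -- Step 1: the symmetric shadow is in the span of the affine generators
  have hpspan := rename_fst_affineColSml_mem_span_affineGen h2w β α hrow hcol hs
  obtain ⟨d, hd⟩ := (Submodule.mem_span_range_iff_exists_fun ℂ).1 hpspan
  refine ⟨d, ?_⟩
  -- Step 2: the candidate as an affine column-sml expression (fold `d` into column `b₀`) and its properties
  set β' : (Fin (n + 1) × (Fin w → Fin (n + 1))) × (Fin w → Fin n) → Fin n → ℂ := fun βτg b =>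
    (if b = b₀ then d βτg.1 else 1) * ((βτg.1.1 : ℕ) : ℂ) with hβ'
  set α' : (Fin (n + 1) × (Fin w → Fin (n + 1))) × (Fin w → Fin n) → Fin n → Fin n → ℂ := fun βτg b a =>
    (if b = b₀ then d βτg.1 else 1) * (1 + ∑ i : Fin w, if βτg.2 i = a then ((βτg.1.2 i : ℕ) : ℂ) else 0) with hα'
  have hfold : ∀ βτg : (Fin (n + 1) × (Fin w → Fin (n + 1))) × (Fin w → Fin n),
      (∏ b : Fin n, (C (β' βτg b) + ∑ a : Fin n, C (α' βτg b a) * X (a, b)) : MvPolynomial (Fin n × Fin n) ℂ) =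
        C (d βτg.1) * ∏ b : Fin n, (C ((βτg.1.1 : ℕ) : ℂ) +
          ∑ a : Fin n, C (1 + ∑ i : Fin w, if βτg.2 i = a then ((βτg.1.2 i : ℕ) : ℂ) else 0) * X (a, b)) := by
    intro βτg
    have hfac : ∀ b : Fin n,
        (C (β' βτg b) + ∑ a : Fin n, C (α' βτg b a) * X (a, b) : MvPolynomial (Fin n × Fin n) ℂ) =
        C (if b = b₀ then d βτg.1 else 1) * (C ((βτg.1.1 : ℕ) : ℂ) +
          ∑ a : Fin n, C (1 + ∑ i : Fin w, if βτg.2 i = a then ((βτg.1.2 i : ℕ) : ℂ) else 0) * X (a, b)) := by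
      intro b
      rw [mul_add]
      simp only [hβ', hα', map_mul, Finset.mul_sum, mul_assoc]
    simp_rw [hfac]
    rw [Finset.prod_mul_distrib, ← map_prod, Finset.prod_ite_eq']
    simp
  have hcol' : ∀ τ' : Equiv.Perm (Fin n), rename (fun v : Fin n × Fin n => (v.1, τ' v.2))
      (∑ t : (Fin (n + 1) × (Fin w → Fin (n + 1))) × (Fin w → Fin n),
        ∏ b : Fin n, (C (β' t b) + ∑ a : Fin n, C (α' t b a) * X (a, b)) : MvPolynomial (Fin n × Fin n) ℂ) =
      ∑ t : (Fin (n + 1) × (Fin w → Fin (n + 1))) × (Fin w → Fin n),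
        ∏ b : Fin n, (C (β' t b) + ∑ a : Fin n, C (α' t b a) * X (a, b)) := by
    intro τ'
    simp_rw [hfold]
    rw [map_sum]
    refine Finset.sum_congr rfl fun βτg _ => ?_
    rw [map_mul, rename_C]
    congr 1
    rw [map_prod]
    have hfac : ∀ b : Fin n, rename (fun v : Fin n × Fin n => (v.1, τ' v.2))
        (C ((βτg.1.1 : ℕ) : ℂ) +
          ∑ a : Fin n, C (1 + ∑ i : Fin w, if βτg.2 i = a then ((βτg.1.2 i : ℕ) : ℂ) else 0) * X (a, b) :
            MvPolynomial (Fin n × Fin n) ℂ) =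
        C ((βτg.1.1 : ℕ) : ℂ) +
          ∑ a : Fin n, C (1 + ∑ i : Fin w, if βτg.2 i = a then ((βτg.1.2 i : ℕ) : ℂ) else 0) * X (a, τ' b) := by
      intro b
      rw [map_add, rename_C]
      congr 1
      simp only [map_sum, map_mul, rename_C, rename_X]
    simp_rw [hfac]
    exact Fintype.prod_equiv τ' _ _ fun b => rfl
  have hren' : rename (Prod.fst : Fin n × Fin n → Fin n)
      (∑ t : (Fin (n + 1) × (Fin w → Fin (n + 1))) × (Fin w → Fin n),
        ∏ b : Fin n, (C (β' t b) + ∑ a : Fin n, C (α' t b a) * X (a, b))) =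
      rename (Prod.fst : Fin n × Fin n → Fin n)
        (∑ t : Fin s, ∏ b : Fin n, (C (β t b) + ∑ a : Fin n, C (α t b a) * X (a, b))) := by
    rw [← hd]
    simp_rw [hfold]
    rw [map_sum, Fintype.sum_prod_type]
    refine Finset.sum_congr rfl fun βτ _ => ?_
    rw [Finset.smul_sum]
    refine Finset.sum_congr rfl fun g _ => ?_
    rw [map_mul, rename_C, rename_fst_prod_affineGenFactor, smul_eq_C_mul]
  -- Step 3: uniqueness
  have huniq := affineColSml_eq_of_rename_fst_eq β α β' α' hcol hcol' hren'.symm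
  rw [huniq]
  exact Finset.sum_congr rfl fun βτg _ => hfold βτg

/-! ### The restoration theorem -/

/-- The diagonal action renames the affine generating factor of column `b` for rows `g` into that of column `σ b` for rows
`σ ∘ g`. [folklore] -/
theorem rename_diag_affineGenFactor {n w : ℕ} (σ : Equiv.Perm (Fin n)) (β : Fin (n + 1)) (τ : Fin w → Fin (n + 1))
    (g : Fin w → Fin n) (b : Fin n) :
    rename (fun pq : Fin n × Fin n => σ • pq)
        (C ((β : ℕ) : ℂ) + ∑ a : Fin n, C (1 + ∑ i : Fin w, if g i = a then ((τ i : ℕ) : ℂ) else 0) * X (a, b) :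
          MvPolynomial (Fin n × Fin n) ℂ) =
      C ((β : ℕ) : ℂ) + ∑ a : Fin n, C (1 + ∑ i : Fin w, if σ (g i) = a then ((τ i : ℕ) : ℂ) else 0) * X (a, σ b) := by
  rw [map_add, rename_C, rename_diag_genFactor]

/-- An affine generating factor has total degree `≤ 1`. [folklore] -/
theorem totalDegree_affineGenFactor_le {n w : ℕ} (β : Fin (n + 1)) (τ : Fin w → Fin (n + 1)) (g : Fin w → Fin n)
    (b : Fin n) :
    (C ((β : ℕ) : ℂ) + ∑ a : Fin n, C (1 + ∑ i : Fin w, if g i = a then ((τ i : ℕ) : ℂ) else 0) * X (a, b) :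
      MvPolynomial (Fin n × Fin n) ℂ).totalDegree ≤ 1 :=
  totalDegree_affineForm_le _ (fun a => 1 + ∑ i : Fin w, if g i = a then ((τ i : ℕ) : ℂ) else 0) b

/-- **THE AFFINE SET-MULTILINEAR STRATUM OF A_∞.**  A matrix-symmetric family with column-set-multilinear `ΣΠΣ` circuits
WITH CONSTANTS (affine column gates) of at most `n^c + c` product gates is quasi-polynomially orbit-restorable. [folklore] -/
theorem affineColSml_restoration :
    ∀ f : (n : ℕ) → MvPolynomial (Fin n × Fin n) ℂ, IsMatrixSymmetric f →
      (∃ c : ℕ, ∀ n : ℕ, ∃ (s : ℕ) (β : Fin s → Fin n → ℂ) (α : Fin s → Fin n → Fin n → ℂ), s ≤ n ^ c + c ∧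
        f n = ∑ t : Fin s, ∏ b : Fin n, (C (β t b) + ∑ a : Fin n, C (α t b a) * X (a, b))) →
      ∃ c' : ℕ, ∀ n : ℕ, QPOrbitRestorable c' n (f n) := by
  intro f hsym ⟨c, hcirc⟩
  classical
  -- large `n`: the affine equivariant normal form with `w = c + 1` slots
  obtain ⟨N₀, hN₀⟩ := exists_pow_add_lt_choose c
  set N₁ := max N₀ (2 * c + 4) with hN₁
  have hform : ∀ n, N₁ ≤ n → ∃ d : Fin (n + 1) × (Fin (c + 1) → Fin (n + 1)) → ℂ,
      f n = ∑ βτg : (Fin (n + 1) × (Fin (c + 1) → Fin (n + 1))) × (Fin (c + 1) → Fin n), C (d βτg.1) *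
        ∏ b : Fin n, (C ((βτg.1.1 : ℕ) : ℂ) +
          ∑ a : Fin n, C (1 + ∑ i : Fin (c + 1), if βτg.2 i = a then ((βτg.1.2 i : ℕ) : ℂ) else 0) * X (a, b)) := by
    intro n hn
    obtain ⟨s, β, α, hs, hf⟩ := hcirc n
    have hrow : ∀ σ : Equiv.Perm (Fin n), rename (fun v : Fin n × Fin n => (σ v.1, v.2))
        (∑ t : Fin s, ∏ b : Fin n, (C (β t b) + ∑ a : Fin n, C (α t b a) * X (a, b)) :
          MvPolynomial (Fin n × Fin n) ℂ) =
        ∑ t : Fin s, ∏ b : Fin n, (C (β t b) + ∑ a : Fin n, C (α t b a) * X (a, b)) := by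
      intro σ; rw [← hf]; simpa using hsym n σ 1
    have hcol : ∀ τ : Equiv.Perm (Fin n), rename (fun v : Fin n × Fin n => (v.1, τ v.2))
        (∑ t : Fin s, ∏ b : Fin n, (C (β t b) + ∑ a : Fin n, C (α t b a) * X (a, b)) :
          MvPolynomial (Fin n × Fin n) ℂ) =
        ∑ t : Fin s, ∏ b : Fin n, (C (β t b) + ∑ a : Fin n, C (α t b a) * X (a, b)) := by
      intro τ; rw [← hf]; simpa using hsym n 1 τ
    have hlt : s < Nat.choose (n - (c + 1 + 1)) (c + 1 + 1) :=
      lt_of_le_of_lt hs (hN₀ n (le_trans (le_max_left _ _) hn))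
    obtain ⟨d, hd⟩ := exists_equivariant_form_affine (w := c + 1) (by omega) β α hrow hcol hlt
    exact ⟨d, hf.trans hd⟩
  choose d hd using hform
  -- the term multisets
  let T : (n : ℕ) → Multiset (Multiset (MvPolynomial (Fin n × Fin n) ℂ)) := fun n =>
    if h : N₁ ≤ n then
      (Finset.univ : Finset ((Fin (n + 1) × (Fin (c + 1) → Fin (n + 1))) × (Fin (c + 1) → Fin n))).val.map fun βτg =>
        C (d n h βτg.1) ::ₘ (Finset.univ : Finset (Fin n)).val.map fun b =>
          C ((βτg.1.1 : ℕ) : ℂ) +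
            ∑ a : Fin n, C (1 + ∑ i : Fin (c + 1), if βτg.2 i = a then ((βτg.1.2 i : ℕ) : ℂ) else 0) * X (a, b)
    else 0
  have hT : ∀ n, IsEquivariantTerms n (2 * (c + 2) + 2) (T n) := by
    intro n
    by_cases h : N₁ ≤ n
    · have hbound : (n + 1) ^ (2 * (c + 2)) ≤ 2 ^ ((Nat.log 2 n + (2 * (c + 2) + 2)) ^ (2 * (c + 2) + 2)) :=
        succ_pow_le_qp (c + 2) n
      simp only [T, dif_pos h]
      refine ⟨?_, ?_, ?_, ?_⟩
      · -- degrees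
        intro m hm ℓ hℓ
        obtain ⟨βτg, _, rfl⟩ := Multiset.mem_map.1 hm
        rcases Multiset.mem_cons.1 hℓ with rfl | hℓ
        · rw [totalDegree_C]; exact Nat.zero_le _
        · obtain ⟨b, _, rfl⟩ := Multiset.mem_map.1 hℓ
          exact totalDegree_affineGenFactor_le _ _ _ _
      · -- number of terms
        rw [Multiset.card_map, Finset.card_val, Finset.card_univ, Fintype.card_prod, Fintype.card_prod, Fintype.card_fun,
          Fintype.card_fun, Fintype.card_fin, Fintype.card_fin, Fintype.card_fin]
        refine le_trans ?_ hbound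
        calc (n + 1) * (n + 1) ^ (c + 1) * n ^ (c + 1) ≤ (n + 1) * (n + 1) ^ (c + 1) * (n + 1) ^ (c + 1) :=
              Nat.mul_le_mul_left _ (Nat.pow_le_pow_left (by omega) _)
          _ = (n + 1) ^ (2 * c + 3) := by rw [← pow_succ', ← pow_add]; ring_nf
          _ ≤ (n + 1) ^ (2 * (c + 2)) := Nat.pow_le_pow_right (by omega) (by omega)
      · -- number of factors per term
        intro m hm
        obtain ⟨βτg, _, rfl⟩ := Multiset.mem_map.1 hm
        rw [Multiset.card_cons, Multiset.card_map, Finset.card_val, Finset.card_univ, Fintype.card_fin]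
        refine le_trans ?_ hbound
        calc n + 1 = (n + 1) ^ 1 := (pow_one _).symm
          _ ≤ (n + 1) ^ (2 * (c + 2)) := Nat.pow_le_pow_right (by omega) (by omega)
      · -- stability under the diagonal action
        intro σ
        rw [Multiset.map_map]
        have hterm : ∀ βτg : (Fin (n + 1) × (Fin (c + 1) → Fin (n + 1))) × (Fin (c + 1) → Fin n),
            ((Multiset.map fun ℓ => rename (fun pq : Fin n × Fin n => σ • pq) ℓ) ∘ fun βτg =>
              C (d n h βτg.1) ::ₘ (Finset.univ : Finset (Fin n)).val.map fun b =>
                C ((βτg.1.1 : ℕ) : ℂ) +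
                  ∑ a : Fin n, C (1 + ∑ i : Fin (c + 1), if βτg.2 i = a then ((βτg.1.2 i : ℕ) : ℂ) else 0) * X (a, b))
                βτg =
            C (d n h βτg.1) ::ₘ (Finset.univ : Finset (Fin n)).val.map fun b =>
              C ((βτg.1.1 : ℕ) : ℂ) +
                ∑ a : Fin n, C (1 + ∑ i : Fin (c + 1), if σ (βτg.2 i) = a then ((βτg.1.2 i : ℕ) : ℂ) else 0) *
                  X (a, b) := by
          intro βτg
          simp only [Function.comp_apply, Multiset.map_cons, rename_C, Multiset.map_map]
          congr 1
          rw [Multiset.map_congr rfl (fun b _ => rename_diag_affineGenFactor σ βτg.1.1 βτg.1.2 βτg.2 b)]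
          exact map_univ_comp_equiv σ (fun b => C ((βτg.1.1 : ℕ) : ℂ) + ∑ a : Fin n,
            C (1 + ∑ i : Fin (c + 1), if σ (βτg.2 i) = a then ((βτg.1.2 i : ℕ) : ℂ) else 0) * X (a, b))
        rw [Multiset.map_congr rfl (fun βτg _ => hterm βτg)]
        exact map_univ_comp_equiv
          (Equiv.prodCongr (Equiv.refl (Fin (n + 1) × (Fin (c + 1) → Fin (n + 1))))
            (Equiv.arrowCongr (Equiv.refl (Fin (c + 1))) σ))
          (fun βτg : (Fin (n + 1) × (Fin (c + 1) → Fin (n + 1))) × (Fin (c + 1) → Fin n) =>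
            C (d n h βτg.1) ::ₘ (Finset.univ : Finset (Fin n)).val.map fun b =>
              C ((βτg.1.1 : ℕ) : ℂ) +
                ∑ a : Fin n, C (1 + ∑ i : Fin (c + 1), if βτg.2 i = a then ((βτg.1.2 i : ℕ) : ℂ) else 0) * X (a, b))
    · simp only [T, dif_neg h]
      refine ⟨by simp, by simp, by simp, fun σ => by simp⟩
  obtain ⟨c₁, hc₁⟩ := stub_circuitOfEquivariantTerms T (2 * (c + 2) + 2) hT
  -- the value of the term multisets for large `n`
  have hval : ∀ n, N₁ ≤ n → ((T n).map Multiset.prod).sum = f n := by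
    intro n h
    simp only [T, dif_pos h, Multiset.map_map]
    rw [hd n h, Finset.sum_eq_multiset_sum]
    refine congrArg _ (Multiset.map_congr rfl fun βτg _ => ?_)
    simp only [Function.comp_apply, Multiset.prod_cons, Finset.prod_eq_multiset_prod]
  refine ⟨max c₁ (N₁.factorial + 5), fun n => ?_⟩
  by_cases h : N₁ ≤ n
  · exact Restorable.qpOrbitRestorable_mono (le_max_left _ _) ((hval n h) ▸ hc₁ n)
  · have hinv : ∀ σ : Equiv.Perm (Fin n), ren σ (f n) = f n := fun σ => ValueOrbit.ren_eq_of_matrixSymmetric (hsym n) σ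
    have h1 := Restorable.qpOrbitRestorable_of_invariant (f n) hinv
    refine Restorable.qpOrbitRestorable_mono ?_ h1
    have : n.factorial ≤ N₁.factorial := Nat.factorial_le (by omega)
    omega

end Summit.ValiantsHypothesis.ValiantsHypothesis.Theorems.SmlAffineRestoration
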